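import Mathlib
import Literature.Analysis.FunctionSpaces.TorusTrigPoly
import Literature.Analysis.FunctionSpaces.TorusDirichletKernel
import HarnessLib

/-!
# Route TaylorCertificates — `PacketLemma`, helper 3: frequency bookkeeping for scalar trigonometric polynomials

Elementary spectrum calculus used in the proof of
`Summit.AnomalousDissipation.AnomalousDissipation.Theses.TaylorCertificates.PacketLemma`
(item stmt-AnomalousDissipation-14032) to see that the oscillatory cross terms of the packet
integrate to zero: "`f` has spectrum in `S`" is the proposition `∃ c, f = Torus.trigPoly S c`
(the scalar function `f : T^d → ℂ` is a trigonometric polynomial `∑_{k∈S} e_k c_k` over the finite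
frequency set `S`; kept inline, no new predicate). The class is closed under sums, scalar multiples, conjugation (`S ↦ -S`), real parts (symmetric
`S`) and **products** (`S, T ↦ S + T`), and `∫ f = 0` whenever `0 ∉ S` (orthogonality of the
characters, `Torus.integral_mFourier`). Frequency cubes (`Torus.freqCube`) add:
`Ω_r + Ω_s ⊆ Ω_{r+s}`, `freqBall N ⊆ Ω_N`, and `0 ∉ Ω_r + {q}` once `|qᵢ| > r` for some `i`.

No definitions; no named facts.
-/

noncomputable section

open MeasureTheory UnitAddTorus Complex
open scoped ComplexConjugate Pointwise

namespace Summit.AnomalousDissipation.AnomalousDissipation.Theorems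

-- the mandated namespace `Summit.<Summit>.<Problem>.Theorems` repeats `AnomalousDissipation` (single-problem summit)
set_option linter.dupNamespace false

open Literature.Analysis.FunctionSpaces Literature.Analysis.FunctionSpaces.Torus

variable {d : Type*} [Fintype d]

omit [Fintype d] in
/-- Scalar `trigPoly` unfolded: `trigPoly S c x = ∑_{k∈S} e_k(x) c k`. [folklore] -/
theorem trigPoly_apply_scalar [Fintype d] (S : Finset (d → ℤ)) (c : (d → ℤ) → ℂ) (x : UnitAddTorus d) :
    trigPoly S c x = ∑ k ∈ S, mFourier k x * c k := by
  rw [trigPoly_apply]; rfl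

/-- Trigonometric polynomials have their spectrum where their coefficients live. [folklore] -/
theorem spec_trigPoly (S : Finset (d → ℤ)) (c : (d → ℤ) → ℂ) : ∃ c₀ : (d → ℤ) → ℂ, trigPoly S c = trigPoly S c₀ := ⟨c, rfl⟩

/-- A function with finite spectrum is continuous. [folklore] -/
theorem spec_continuous {S : Finset (d → ℤ)} {f : UnitAddTorus d → ℂ} (hf : ∃ c : (d → ℤ) → ℂ, f = trigPoly S c) :
    Continuous f := by
  obtain ⟨c, rfl⟩ := hf; exact continuous_trigPoly S c

/-- Enlarging the frequency set. [folklore] -/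
theorem spec_mono {S T : Finset (d → ℤ)} {f : UnitAddTorus d → ℂ} (hf : ∃ c : (d → ℤ) → ℂ, f = trigPoly S c) (hST : S ⊆ T) :
    ∃ c : (d → ℤ) → ℂ, f = trigPoly T c := by
  classical
  obtain ⟨c, rfl⟩ := hf
  refine ⟨fun k => if k ∈ S then c k else 0, ?_⟩
  rw [trigPoly_subset hST (c := fun k => if k ∈ S then c k else 0) fun k _ hk => if_neg hk]
  exact trigPoly_congr fun k hk => (if_pos hk).symm

/-- Sums. [folklore] -/
theorem spec_add {S : Finset (d → ℤ)} {f g : UnitAddTorus d → ℂ} (hf : ∃ c : (d → ℤ) → ℂ, f = trigPoly S c)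
    (hg : ∃ c : (d → ℤ) → ℂ, g = trigPoly S c) : ∃ c : (d → ℤ) → ℂ, f + g = trigPoly S c := by
  obtain ⟨c, rfl⟩ := hf; obtain ⟨c', rfl⟩ := hg
  exact ⟨c + c', (trigPoly_add S c c').symm⟩

/-- Differences. [folklore] -/
theorem spec_sub {S : Finset (d → ℤ)} {f g : UnitAddTorus d → ℂ} (hf : ∃ c : (d → ℤ) → ℂ, f = trigPoly S c)
    (hg : ∃ c : (d → ℤ) → ℂ, g = trigPoly S c) : ∃ c : (d → ℤ) → ℂ, f - g = trigPoly S c := by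
  obtain ⟨c, rfl⟩ := hf; obtain ⟨c', rfl⟩ := hg
  exact ⟨c - c', (trigPoly_sub S c c').symm⟩

/-- Scalar multiples. [folklore] -/
theorem spec_const_mul {S : Finset (d → ℤ)} {f : UnitAddTorus d → ℂ} (hf : ∃ c : (d → ℤ) → ℂ, f = trigPoly S c) (a : ℂ) :
    ∃ c : (d → ℤ) → ℂ, (fun x => a * f x) = trigPoly S c := by
  obtain ⟨c, rfl⟩ := hf
  refine ⟨a • c, ?_⟩
  rw [trigPoly_smul]; rfl

/-- A single character `e_q` has spectrum `{q}`. [folklore] -/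
theorem spec_mFourier (q : d → ℤ) : ∃ c : (d → ℤ) → ℂ, (fun x : UnitAddTorus d => (mFourier q x : ℂ)) = trigPoly {q} c := by
  refine ⟨fun _ => 1, funext fun x => ?_⟩
  rw [trigPoly_apply_scalar, Finset.sum_singleton, mul_one]

/-- Constants have spectrum `{0}`. [folklore] -/
theorem spec_const (a : ℂ) : ∃ c : (d → ℤ) → ℂ, (fun _ : UnitAddTorus d => a) = trigPoly {(0 : d → ℤ)} c := by
  refine ⟨fun _ => a, funext fun x => ?_⟩
  rw [trigPoly_apply_scalar, Finset.sum_singleton, mFourier_zero, ContinuousMap.one_apply, one_mul]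

/-- **Products multiply spectra additively**: spec `S` times spec `T` lands in spec `S + T`
(`e_k e_l = e_{k+l}`, regrouping the double sum along the fibres of `(k, l) ↦ k + l`). [folklore] -/
theorem spec_mul [DecidableEq d] {S T : Finset (d → ℤ)} {f g : UnitAddTorus d → ℂ}
    (hf : ∃ c : (d → ℤ) → ℂ, f = trigPoly S c) (hg : ∃ c : (d → ℤ) → ℂ, g = trigPoly T c) :
    ∃ c : (d → ℤ) → ℂ, f * g = trigPoly (S + T) c := by
  obtain ⟨c, rfl⟩ := hf; obtain ⟨c', rfl⟩ := hg
  refine ⟨fun m => ∑ p ∈ (S ×ˢ T).filter (fun p => p.1 + p.2 = m), c p.1 * c' p.2, funext fun x => ?_⟩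
  rw [Pi.mul_apply, trigPoly_apply_scalar, trigPoly_apply_scalar, trigPoly_apply_scalar,
    Finset.sum_mul_sum, ← Finset.sum_product']
  have hmaps : ∀ p ∈ S ×ˢ T, p.1 + p.2 ∈ S + T := fun p hp => by
    rw [Finset.mem_product] at hp
    exact Finset.add_mem_add hp.1 hp.2
  rw [← Finset.sum_fiberwise_of_maps_to hmaps]
  refine Finset.sum_congr rfl fun m _ => ?_
  rw [Finset.mul_sum]
  refine Finset.sum_congr rfl fun p hp => ?_
  rw [Finset.mem_filter] at hp
  rw [← hp.2, mFourier_add]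
  ring

/-- Multiplication by a character shifts the spectrum: spec `S` becomes spec `S + {q}` for `f e_q`. [folklore] -/
theorem spec_mul_mFourier [DecidableEq d] {S : Finset (d → ℤ)} {f : UnitAddTorus d → ℂ}
    (hf : ∃ c : (d → ℤ) → ℂ, f = trigPoly S c) (q : d → ℤ) :
    ∃ c : (d → ℤ) → ℂ, (fun x => f x * mFourier q x) = trigPoly (S + {q}) c :=
  spec_mul hf (spec_mFourier q)

/-- Conjugation reflects the spectrum: spec `S` becomes spec `-S` for `conj ∘ f`. [folklore] -/
theorem spec_conj [DecidableEq d] {S : Finset (d → ℤ)} {f : UnitAddTorus d → ℂ} (hf : ∃ c : (d → ℤ) → ℂ, f = trigPoly S c) :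
    ∃ c : (d → ℤ) → ℂ, (fun x => conj (f x)) = trigPoly (S.image Neg.neg) c := by
  obtain ⟨c, rfl⟩ := hf
  refine ⟨fun k => conj (c (-k)), funext fun x => ?_⟩
  rw [trigPoly_apply_scalar, trigPoly_apply_scalar, map_sum,
    Finset.sum_image fun k _ l _ (h : -k = -l) => neg_injective h]
  refine Finset.sum_congr rfl fun k _ => ?_
  rw [map_mul, ← mFourier_neg, neg_neg]

/-- On a symmetric frequency set, conjugation preserves the spectrum. [folklore] -/
theorem spec_conj_symm [DecidableEq d] {S : Finset (d → ℤ)} (hS : ∀ k ∈ S, -k ∈ S)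
    {f : UnitAddTorus d → ℂ} (hf : ∃ c : (d → ℤ) → ℂ, f = trigPoly S c) :
    ∃ c : (d → ℤ) → ℂ, (fun x => conj (f x)) = trigPoly S c := by
  refine spec_mono (spec_conj hf) fun k hk => ?_
  obtain ⟨l, hl, rfl⟩ := Finset.mem_image.1 hk
  exact hS l hl

/-- On a symmetric frequency set, the real part (as a complex function) keeps the spectrum:
`Re f = (f + conj f)/2`. [folklore] -/
theorem spec_ofReal_re [DecidableEq d] {S : Finset (d → ℤ)} (hS : ∀ k ∈ S, -k ∈ S)
    {f : UnitAddTorus d → ℂ} (hf : ∃ c : (d → ℤ) → ℂ, f = trigPoly S c) :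
    ∃ c : (d → ℤ) → ℂ, (fun x => (((f x).re : ℝ) : ℂ)) = trigPoly S c := by
  have h : (fun x => (((f x).re : ℝ) : ℂ)) = fun x => (2 : ℂ)⁻¹ * ((f + fun y => conj (f y)) x) := by
    funext x
    rw [Pi.add_apply, Complex.re_eq_add_conj]
    ring
  rw [h]
  exact spec_const_mul (spec_add hf (spec_conj_symm hS hf)) _

/-- **Integral of a trigonometric polynomial**: only the zero mode survives,
`∫ trigPoly S c = 𝟙_S(0) c 0`. [folklore] -/
theorem integral_trigPoly_scalar [DecidableEq d] (S : Finset (d → ℤ)) (c : (d → ℤ) → ℂ) :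
    ∫ x, trigPoly S c x = if (0 : d → ℤ) ∈ S then c 0 else 0 := by
  simp_rw [trigPoly_apply_scalar]
  rw [integral_finsetSum S (f := fun k x => mFourier k x * c k)
    fun k _ => ((mFourier k).continuous.mul continuous_const).integrable_unitAddTorus]
  simp_rw [integral_mul_const, integral_mFourier, ite_mul, one_mul, zero_mul]
  rw [Finset.sum_ite_eq']

/-- **Oscillatory integrals vanish**: if `0 ∉ S` then `∫ f = 0` for every `f` with spectrum in `S`. [folklore] -/
theorem spec_integral_eq_zero [DecidableEq d] {S : Finset (d → ℤ)} {f : UnitAddTorus d → ℂ}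
    (hf : ∃ c : (d → ℤ) → ℂ, f = trigPoly S c) (h0 : (0 : d → ℤ) ∉ S) : ∫ x, f x = 0 := by
  obtain ⟨c, rfl⟩ := hf
  rw [integral_trigPoly_scalar, if_neg h0]

/-! ### Frequency cubes -/

/-- Cubes add: `Ω_r + Ω_s ⊆ Ω_{r+s}`. [folklore] -/
theorem freqCube_add_subset [DecidableEq d] (r s : ℕ) :
    freqCube (d := d) r + freqCube s ⊆ freqCube (r + s) := by
  intro m hm
  obtain ⟨k, hk, l, hl, rfl⟩ := Finset.mem_add.1 hm
  rw [mem_freqCube] at hk hl ⊢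
  intro i
  have := hk i; have := hl i
  simp only [Pi.add_apply, Nat.cast_add]
  omega

/-- Cubes are nested. [folklore] -/
theorem freqCube_mono [DecidableEq d] {r s : ℕ} (h : r ≤ s) : freqCube (d := d) r ⊆ freqCube s := by
  intro k hk
  rw [mem_freqCube] at hk ⊢
  intro i
  have := hk i
  omega

/-- The frequency ball sits in the cube of the same radius. [folklore] -/
theorem freqBall_subset_freqCube [DecidableEq d] (N : ℕ) : freqBall (d := d) N ⊆ freqCube N := by
  intro k hk
  exact (Finset.mem_filter.1 hk).1

/-- A cube shifted by a frequency `q` with some coordinate `|qᵢ| > r` misses the origin. [folklore] -/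
theorem zero_not_mem_freqCube_add_singleton [DecidableEq d] {r : ℕ} {q : d → ℤ}
    (hq : ∃ i, (r : ℤ) < |q i|) : (0 : d → ℤ) ∉ freqCube r + ({q} : Finset (d → ℤ)) := by
  intro h
  obtain ⟨k, hk, l, hl, hkl⟩ := Finset.mem_add.1 h
  rw [Finset.mem_singleton] at hl
  rw [hl] at hkl
  obtain ⟨i, hi⟩ := hq
  have hki := (mem_freqCube.1 hk) i
  have h0 : k i + q i = 0 := by
    have := congr_fun hkl i
    simpa using this
  have : |q i| ≤ r := by rw [abs_le]; omega
  omega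

end Summit.AnomalousDissipation.AnomalousDissipation.Theorems
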